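import Literature.NumberTheory.EllipticCurves.IwasawaModuleFinitePadicIntProofs
import Literature.NumberTheory.EllipticCurves.Kobayashi2003.SignedSelmerDualExistsProofs
import HarnessLib

/-!
# Seed crux `SignedMuSeedAtTwoPlus` (stmt-BirchSwinnertonDyer-21438), line `fine-plus-split`: stub 2
# `SplitFiniteness` VERBATIM — fine half + plus-local half ⟹ `Sel⁺(A/ℚ_∞)[2]` finite

Cell `bsd-wall`, width seat `bsd-wall-rtt-p4-w3` (g3). THEOREMS ONLY (no `def`, no named fact, no `sorry`); helper
`--supports` the seed crux (= `stub_residualSeedAtTwo` of line `birth` of Kμ⁺ stmt-BirchSwinnertonDyer-20689); BSD is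
not proved by this. Route-independent imports.

The structural stub of line `fine-plus-split` (`Cruxes/SignedMuSeedAtTwoPlus/Lines/fine_plus_split.lean`, stub 2
`SplitFiniteness`, "size M") is the exact sequence `0 → Sel₀[2] ∩ Sel⁺ → Sel⁺[2] → H¹/Sel₀` read for finiteness:

* §1 `finite_of_finite_image_of_finite_sub` — a set `T` in an abelian group whose image modulo a subgroup `S₀` is
  finite and whose differences inside `S₀` are confined to a finite set is finite (choose a representative per image
  class; `x ↦ (class of x, x − representative)` is injective into a finite product).
* §2 **`splitFiniteness`** = `SplitFiniteness` VERBATIM (`FineMuZeroAtTwo`, `PlusLocalHalf` unfolded): for `A/ℚ`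
  elliptic, `κ` cyclotomic with topological generator `γ`: statement (A) at `(A, 2)` — some fine Selmer dual datum
  with `X₀` finitely generated over `ℤ₂` — gives `Sel₀(ℚ_∞, A[2^∞])[2]` finite (tree
  `IwasawaModuleFinitePadicInt.finite_pTorsion_of_fineSelmerDualData_moduleFinite`, Pontryagin duality), and the
  plus-local half — the image of `Sel⁺(A/ℚ_∞)[2]` in `H¹(ℚ_∞, A[2^∞])/Sel₀` is finite — then makes `Sel⁺(A/ℚ_∞)[2]`
  finite by §1. Neither cyclotomicity nor the generator is used.

References: [CoatesSujatha2005] J. Coates, R. Sujatha, Math. Ann. 331 (2005) §3 (Conjecture A); [Kobayashi2003]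
S. Kobayashi, Invent. Math. 152 (2003) Def. 1.1; [GreenbergLNM1716] §1 p. 60.
-/

set_option autoImplicit false
set_option linter.dupNamespace false

noncomputable section

open scoped Classical

open WeierstrassCurve Literature.NumberTheory.EllipticCurves Literature.NumberTheory.EllipticCurves.IwasawaAlgebra
  Literature.NumberTheory.EllipticCurves.Kobayashi2003 Literature.NumberTheory.EllipticCurves.ZpExtension

namespace Summit.BirchSwinnertonDyer.BirchSwinnertonDyer.Theorems.SignedMuAtTwo.FineSplit

universe u

/-! ## §1. Finite image modulo a subgroup + finite differences ⟹ finite -/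

/-- **Finiteness from a finite image and finite fibres.** Let `S₀ ≤ H` be a subgroup of an abelian group, `T ⊆ H` a
set whose image in `H/S₀` is finite, and `F ⊆ H` a finite set such that `x − y ∈ F` whenever `x, y ∈ T` have the same
image. Then `T` is finite. [folklore] -/
theorem finite_of_finite_image_of_finite_sub {H : Type u} [AddCommGroup H] (S₀ : AddSubgroup H) (T F : Set H)
    (himage : ((QuotientAddGroup.mk' S₀) '' T).Finite) (hF : F.Finite)
    (hsub : ∀ x ∈ T, ∀ y ∈ T, (QuotientAddGroup.mk' S₀) x = (QuotientAddGroup.mk' S₀) y → x - y ∈ F) :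
    T.Finite := by
  -- a representative in `T` of each image class
  have hrep : ∀ c : (QuotientAddGroup.mk' S₀) '' T, ∃ x : H, x ∈ T ∧ (QuotientAddGroup.mk' S₀) x = c := by
    rintro ⟨c, x, hx, rfl⟩
    exact ⟨x, hx, rfl⟩
  choose rep hrepT hrepc using hrep
  haveI : Finite ((QuotientAddGroup.mk' S₀) '' T) := himage.to_subtype
  haveI : Finite F := hF.to_subtype
  let cls : T → (QuotientAddGroup.mk' S₀) '' T := fun x ↦ ⟨(QuotientAddGroup.mk' S₀) x, x, x.2, rfl⟩
  have hcls : ∀ x : T, ((cls x : (QuotientAddGroup.mk' S₀) '' T) : H ⧸ S₀) = (QuotientAddGroup.mk' S₀) x :=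
    fun _ ↦ rfl
  let f : T → ((QuotientAddGroup.mk' S₀) '' T) × F := fun x ↦
    (cls x, ⟨(x : H) - rep (cls x), hsub x x.2 _ (hrepT _) (by rw [hrepc (cls x), hcls])⟩)
  have hf : Function.Injective f := by
    rintro ⟨x, hx⟩ ⟨y, hy⟩ hxy
    simp only [f, Prod.mk.injEq, Subtype.mk.injEq] at hxy
    obtain ⟨h1, h2⟩ := hxy
    apply Subtype.ext
    rw [h1] at h2
    exact sub_left_injective h2
  exact Set.finite_coe_iff.mp (Finite.of_injective f hf)

/-! ## §2. Stub 2 `SplitFiniteness` of line `fine-plus-split`, verbatim -/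

/-- **Stub 2 `stub_splitFiniteness` of line `fine-plus-split` (seed crux `SignedMuSeedAtTwoPlus`,
stmt-BirchSwinnertonDyer-21438) — its statement `SplitFiniteness` VERBATIM** (`FineMuZeroAtTwo A` = «for every
cyclotomic `κ` some fine Selmer dual datum has `X₀` finitely generated over `ℤ₂`», `PlusLocalHalf A κ` = «the image of
`Sel⁺(A/ℚ_∞)[2]` in `H¹(ℚ_∞, A[2^∞])/Sel₀(ℚ_∞, A[2^∞])` is finite», both unfolded). Proof: (A) gives
`Sel₀(ℚ_∞, A[2^∞])[2]` finite (tree `finite_pTorsion_of_fineSelmerDualData_moduleFinite`); two `2`-torsion plus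
classes with the same image differ by an element of `Sel₀[2]`; §1. [cite: CoatesSujatha2005, §3 (Conjecture A)]
[cite: Kobayashi2003, Def. 1.1] [cite: GreenbergLNM1716, §1 p. 60] -/
theorem splitFiniteness :
    ∀ (A : WeierstrassCurve ℚ) [A.IsElliptic] (κ : ZpExtension ℚ 2) (γ : Field.absoluteGaloisGroup ℚ),
      κ.IsCyclotomic → κ.IsTopGenerator γ →
      (∀ (κ' : ZpExtension ℚ 2), κ'.IsCyclotomic →
        ∃ (γ' : Field.absoluteGaloisGroup ℚ) (D : A.FineSelmerDualData κ' γ'),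
          Module.Finite ℤ_[2] (RestrictScalars ℤ_[2] (IwasawaAlgebra 2) D.X)) →
      ((QuotientAddGroup.mk' (A.fineSelmerInfty κ)) ''
        {x : A.subgroupH1 2 κ.kerSubgroup | x ∈ signedSelmerInfty A κ 1 ∧ 2 • x = 0}).Finite →
      {s : signedSelmerInfty A κ 1 | 2 • s = 0}.Finite := by
  intro A _ κ γ hκ _ hF hL
  -- the fine half: `Sel₀[2]` is finite
  obtain ⟨γ', D, hD⟩ := hF κ hκ
  have hfine : {s : A.fineSelmerInfty κ | 2 • s = 0}.Finite :=
    IwasawaModuleFinitePadicInt.finite_pTorsion_of_fineSelmerDualData_moduleFinite A κ D hD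
  -- its image in `H¹`
  set F : Set (A.subgroupH1 2 κ.kerSubgroup) :=
    (fun s : A.fineSelmerInfty κ ↦ (s : A.subgroupH1 2 κ.kerSubgroup)) '' {s | 2 • s = 0} with hFdef
  have hFfin : F.Finite := hfine.image _
  -- the set of `2`-torsion plus classes in `H¹` is finite
  have hT : {x : A.subgroupH1 2 κ.kerSubgroup | x ∈ signedSelmerInfty A κ 1 ∧ 2 • x = 0}.Finite := by
    refine finite_of_finite_image_of_finite_sub (A.fineSelmerInfty κ) _ F hL hFfin ?_
    intro x hx y hy hxy
    rw [QuotientAddGroup.mk'_apply, QuotientAddGroup.mk'_apply, QuotientAddGroup.eq_iff_sub_mem] at hxy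
    refine ⟨⟨x - y, hxy⟩, ?_, rfl⟩
    change 2 • (⟨x - y, hxy⟩ : A.fineSelmerInfty κ) = 0
    apply Subtype.ext
    change 2 • (x - y) = 0
    rw [smul_sub, hx.2, hy.2, sub_zero]
  -- pull back along the injective coercion `Sel⁺ → H¹`
  refine Set.Finite.of_finite_image (f := fun s : signedSelmerInfty A κ 1 ↦ (s : A.subgroupH1 2 κ.kerSubgroup))
    (hT.subset ?_) (Subtype.coe_injective.injOn)
  rintro _ ⟨s, hs, rfl⟩
  refine ⟨s.2, ?_⟩
  change ((2 • s : signedSelmerInfty A κ 1) : A.subgroupH1 2 κ.kerSubgroup) = 0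
  rw [show (2 • s : signedSelmerInfty A κ 1) = 0 from hs]
  rfl

end Summit.BirchSwinnertonDyer.BirchSwinnertonDyer.Theorems.SignedMuAtTwo.FineSplit

end
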